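import Literature.NumberTheory.Sieve.FriedlanderIwaniecPrimesCrudeBound
import Literature.NumberTheory.Sieve.FriedlanderIwaniecPrimesProofs
import Literature.NumberTheory.LFunctions.MertensElementary
import Mathlib.Analysis.SpecificLimits.Normed
import Mathlib.Analysis.PSeries
import HarnessLib

/-!
# Friedlander–Iwaniec, *The polynomial `X² + Y⁴` captures its primes*: Proposition 2.1 with hypothesis (2.8) in the form its proof consumes; the divisor cube moment of `a_n`

Trunk T-SIEVE, family `parity`. Sources: J. Friedlander, H. Iwaniec, *The polynomial `X² + Y⁴`
captures its primes*, Ann. of Math. (2) 148 (1998), 945–1040 [FriedlanderIwaniecAnnals1998], §2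
(2.1)–(2.17), Proposition 2.1, Lemma 2.2; and the companion paper whose Theorems 2–3 Proposition 2.1
restates, J. Friedlander, H. Iwaniec, *Asymptotic sieve for primes*, Ann. of Math. (2) 148 (1998),
1041–1065 [FriedlanderIwaniecASP1998] (= arXiv:math/9811186v1; read for this file from the arXiv
PDF — the lit-store record `paper:arxiv-math_9811186` is a broken extraction, re-acquisition
requested): §1 (1.6), (1.16); §2 pp. 1046–1047 (Lemma 1, (R′), (B′)); §9 pp. 1058–1063 (Theorem 2:
(9.1)–(9.3), (R₃), (R′₃), Lemma 2, the estimates `E₂₁`, `E₂₂ ≤ (S₁S₂)^{1/2}`, (9.12)); §10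
pp. 1063–1065 (Theorem 3: (B*), `W₁`, `W₀`).

## Why this file exists

`FriedlanderIwaniecPrimes` vendors Proposition 2.1 as printed (`FriedlanderIwaniec1998_prop21`,
hypotheses `SieveSequence.FI1998SieveHypotheses` = (2.1)–(2.15)), and FI apply it (§§3–4) to the
sequence `a_n = #{(a, c) : a² + c⁴ = n}`. Its hypothesis (2.8) = ASP (1.6),
"`A_d(x) ≪ d⁻¹ τ(d)⁸ A(x)` uniformly in `d ≤ x^{1/3}`", is FALSE for `a_n`
(`FriedlanderIwaniec1998_hyp28_false`, `FriedlanderIwaniecPrimesHyp28`), so the printed reduction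
"(2.1)–(2.15) for `a_n` ⟹ (4.7)" is vacuous. The proof of Proposition 2.1 is that of ASP Theorem 2
(support not restricted to squarefree numbers, §9) with the modification of Theorem 3 (§10, the
condition `(n, Π) = 1`). Reading that proof for every invocation of (1.6):

1. §2 p. 1047 — (R), (B) ⟹ (R′), (B′) via Lemma 1 ("Any squarefree integer `n ≥ 1` has a divisor
   `d ≤ n^{1/k}` such that `τ(n) ≤ (2τ(d))^k`") and (1.6): there `a_n` is supported on squarefree
   numbers ((1.16)), so the moduli `d ∣ n` are SQUAREFREE. In the proof of Theorem 2 this is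
   applied to `ã_n = μ²(n) a_n` (9.4), whose (1.6) at squarefree `d` follows from that of `a_n` at
   squarefree `d` and (9.12) (p. 1062, last display: "`Ã_d(x) ≤ A_d(x) ≪ d⁻¹τ(d)⁸A(x) ≪
   d⁻¹τ(d)⁸Ã(x)`").
2. §9 p. 1060 — (R₃) ⟹ (R′₃): "By (1.6) `∑³_{d ≤ x^{1/3}} τ(d)^{10} A_d(x) ≪ A(x) ∑_{d ≤ x^{1/3}}
   d⁻¹τ(d)^{18}`", the superscript `3` restricting to CUBEFREE moduli.
3. §9 p. 1062 — the estimate of `E₂₂ ≤ (S₁ S₂)^{1/2}`: "To estimate `S₂` we apply Lemma 2 with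
   `k = 3` getting by (1.6) `S₂ = ∑_{n ≤ x} a_n τ(n)³ ≤ ∑_{d ≤ x^{1/3}} A_d(x)(2τ(d))^{9 log 3/log 2}
   ≪ A(x) ∑_{d ≤ x} d⁻¹ τ(d)^{9 log 3/log 2 + 8} ≪ A(x)(log x)^{3⁹+8}`" (so printed; the chain gives
   the exponent `2⁸3⁹`, and every exponent `< 2²³ - 2` serves the sequel). Lemma 2 ("Any `n ≥ 1`
   has a divisor `d ≤ n^{1/k}` ...") produces ARBITRARY moduli `d` (for `n = p⁹ m`, `p³ ∣ d`):
   this is the one place where (1.6) is used beyond cubefree moduli, and only through its output,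
   the divisor moment bound `S₂ ≪ A(x)(log x)^{O(1)}`.
4. §10 p. 1064 — `W₁`: "By Lemma 1 for `k = 4` we obtain `τ₄(n) ≤ τ(n)³ ≤ (2τ(ν))^{24}` for some
   `ν ∣ n`, `ν ≤ x^{1/4}` and hence by (1.6) `W₁ ≤ (log C) ∑_{d ∣ Π, Δ < d ≤ ΔP}
   ∑♭_{ν ≤ x^{1/4}, (ν,d)=1} (2τ(ν))^{24} A_{νd}(x)`" with `n` squarefree (`μ²(m n₀ n₁)`), `d ∣ Π`
   squarefree, `(ν, d) = 1`: SQUAREFREE moduli `νd`; and p. 1065, `W₀`: "By the argument that gave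
   (B) ⟹ (B′)" — item 1 again, squarefree moduli.

Hence the printed proof of Proposition 2.1 consumes (2.8) exactly in the form "(2.8) for cubefree
`d ≤ x^{1/3}`" **and** "(2.8′) `∑_{n ≤ x} a_n τ(n)³ ≪ A(x)(log x)^{2⁸3⁹}`", and BOTH HOLD for the
sequence `a_n` of (4.1): the first is `FriedlanderIwaniec1998_hyp28_cubefree_holds`
(`FriedlanderIwaniecPrimesCrudeBound`), the second is PROVED here
(`FriedlanderIwaniec1998_hyp28_moment_holds`). This file vendors Proposition 2.1 with this consumed
form of (2.8) (`FriedlanderIwaniec1998_prop21_consumed`, a named fact) and re-assembles parity.S17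
from non-refuted inputs: **`friedlanderIwaniecSum_isEquivalent_of_consumedInputs`** derives FI
Theorem 1 from the FOUR named facts `FriedlanderIwaniec1998_prop21_consumed` (asymptotic sieve for
primes), `_prop35` (level of distribution, §3), `_prop41` (the bilinear form bound, §§4–26) and
`_hyp27` ((2.7), Mertens' theorem for `χ₄` with a prime-number-theorem error term), every other
input of the printed architecture being a theorem of the tree.

## The divisor cube moment of `a_n` (proof of (2.8′))

* `exists_divisor_card_divisors_le` (ASP Lemma 2, `k = 3`, integral exponents): every `n ≥ 1` has a
  divisor `d` with `d³ ≤ n` and `τ(n) ≤ (2τ(d))⁵` (`d = ∏_{p^F ∥ n, F ≥ 3} p^{⌊F/3⌋} · ∏_{p ∈ T} p`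
  for a set `T` of small-exponent primes with `(∏T)³ ≤ ∏` and `#{small-exponent primes} ≤ 3#T + 2`,
  `exists_subset_prod_pow_three_le`); hence `τ(n)³ ≤ 2^{15} τ(d_n)^{15}`.
* Root counts for all moduli: `N(p^k, t) ≤ (k+1) p^{⌊k/2⌋}` (`sqCongrCount_prime_pow_le`: two roots
  have `p^a ∣ ν - ν₀`, `p^{k-a} ∣ ν + ν₀`), so with the loss factor `f(d) = ∏_{p^k ∥ d, k ≥ 3} p^{⌊k/2⌋}`
  (`fiLoss`) the induction of `FriedlanderIwaniecPrimesCrudeBound` gives `N(d, -c⁴) ≤ τ(d)² f(d) g`,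
  `g ∣ c`, `g² ∣ d` (`sqCongrCount_le_general`), whence `A_d(x) ≤ 9 τ(d)³ f(d) x^{3/4}/d` for
  `d ≤ x^{1/3}` (`congrSum_le_rpow_general`; at `d = p⁴`, `f = p²`, consistent with
  `FriedlanderIwaniec1998_hyp28_false`).
* `∑_{d ≤ Y} h(d) ≤ ∏_{p ≤ Y} ∑_{k ≤ log₂ Y} h(p^k)` for nonnegative multiplicative `h`
  (`sum_Icc_le_prod_primesLE_sum`), applied to `h(d) = τ(d)^{18} f(d)/d` (`fiMomentWeight`): the local
  factor is `≤ 1 + 2^{18}/p + (3^{18} + 4E₁)/p²` with `E₁ = ∑_k (k+1)^{18} 2^{-k/2}`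
  (`sum_fiMomentWeight_prime_pow_le`), and `1 + u ≤ e^u`, Mertens' `∑_{p ≤ Y} 1/p ≤ log log Y + 4`
  (the tree's `Literature.NumberTheory.LFunctions.MertensBound.sum_inv_prime_le`) and `∑_p p⁻² ≤ 1` give
  `∑_{d ≤ Y} h(d) ≤ e^{2^{20} + E₀} (log Y)^{2^{18}}` (`sum_fiMomentWeight_le`).
* Assembly (`FriedlanderIwaniecPrimes.divisorCubeMoment_unfolded`):
  `∑_{n ≤ x} a_n τ(n)³ ≤ 2^{15} ∑_{d ≤ x^{1/3}} τ(d)^{15} A_d(x) ≤ 9·2^{15} x^{3/4} ∑_d h(d)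
  ≤ 9·2^{15} e^{2^{20}+E₀} x^{3/4} (log x)^{2^{18}} ≤ K A(x) (log x)^{2⁸3⁹}`.

## References

* J. Friedlander, H. Iwaniec, *The polynomial `X² + Y⁴` captures its primes*, Ann. of Math. (2)
  148 (1998), 945–1040, §2 (2.1)–(2.17), Proposition 2.1; §§3–4. [FriedlanderIwaniecAnnals1998]
* J. Friedlander, H. Iwaniec, *Asymptotic sieve for primes*, Ann. of Math. (2) 148 (1998),
  1041–1065 = arXiv:math/9811186: §2 p. 1047; §9 pp. 1058–1063 (Theorem 2, Lemma 2, `S₂`); §10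
  pp. 1063–1065 (Theorem 3). [FriedlanderIwaniecASP1998]
* G. H. Hardy, E. M. Wright, *An Introduction to the Theory of Numbers*, 6th ed., Thm 427 (Mertens'
  bound, as proved in the tree's `MertensElementary`). [HardyWright2008]

## Tree

`sqCongrCount`, `sqCongrCount_mul_le`, `sqCongrCount_prime_le`, `sqCongrCount_prime_sq_le_two`,
`sqCongrCount_prime_sq_le_of_dvd`, `card_filter_dvd_sq_add_le`, `card_box_filter_eq_sum`,
`sum_le_of_dvd_of_sq_dvd`, `congrSum_le_card_box`, `nat_sqrt_floor_le_sqrt`,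
`nat_sqrt_sqrt_floor_le_rpow`, `one_le_card_divisors`, `card_divisors_prime_pow`,
`fiSieveSeq_hypothesesCubefree`, `FriedlanderIwaniec1998_hyp28_cubefree_holds`
(`FriedlanderIwaniecPrimesCrudeBound.lean`); `FriedlanderIwaniec1998_densityConstant_holds`
(`FriedlanderIwaniecPrimesProofs.lean`); `fiCount_bounds`, `FriedlanderIwaniec1998_count_asymp_holds`,
`friedlanderIwaniecSum_isEquivalent_of_primeSum` (`FriedlanderIwaniecPrimes.lean`);
`Literature.NumberTheory.LFunctions.MertensBound.sum_inv_prime_le` (`MertensElementary.lean`). Related: the sum-versus-Euler-product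
comparison `sum_Icc_le_prod_primesLE_sum` is a finite-exponent (`k ≤ log₂ Y`) sibling of
`sum_le_prod_tsum_of_factored` (`BombieriAsymptoticSieveMertens.lean`, a `tsum` form over
`Nat.factoredNumbers`), kept local to avoid that file's import closure. Mathlib:
`Nat.recOnPosPrimePosCoprime`, `Nat.multiplicative_factorization`, `Nat.eq_of_factorization_eq`,
`Finset.prod_sum` (the `Finset.pi` expansion), `Finset.strongInduction`,
`summable_pow_mul_geometric_of_norm_lt_one`, `Summable.sum_le_tsum`, `sum_Ioo_inv_sq_le`,
`Real.add_one_le_exp`, `Real.exp_sum`.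
-/

noncomputable section

open Filter Finset Real Asymptotics
open scoped Topology

namespace Literature.NumberTheory.Sieve.SieveSequence

/-- **Hypothesis (2.8′), the divisor cube moment**: `∑_{n ≤ x} a_n τ(n)³ ≤ K A(x) (log x)^{2⁸3⁹}`
for all large `x` — the bound for `S₂` obtained in [FriedlanderIwaniecASP1998] §9 p. 1062 ("To
estimate `S₂` we apply Lemma 2 with `k = 3` getting by (1.6) `S₂ = ∑_{n ≤ x} a_n τ(n)³ ≪ ...
≪ A(x)(log x)^{3⁹+8}`"; the displayed chain `∑_{d ≤ x} d⁻¹τ(d)^m ≪ (log x)^{2^m}`,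
`m = 9 log 3/log 2 + 8`, yields the exponent `2^m = 2⁸3⁹`, which is the one recorded here; the
sequel only needs any fixed exponent `< 2²³ - 2`), i.e. the only consequence of (1.6) = FI (2.8) at
non-cubefree moduli that the proof of Theorem 2 (= FI Proposition 2.1) uses. `τ = σ₀`.
[cite: FriedlanderIwaniecASP1998, §9 p. 1062 (estimate of S₂)] -/
def FI1998DivisorCubeMoment (A : SieveSequence) : Prop :=
  ∃ K : ℝ, ∀ᶠ x : ℝ in atTop,
    ∑ n ∈ Icc 1 ⌊x⌋₊, A.a n * (ArithmeticFunction.sigma 0 n : ℝ) ^ 3 ≤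
      K * A.size x * Real.log x ^ (2 ^ 8 * 3 ^ 9)

end Literature.NumberTheory.Sieve.SieveSequence

namespace Literature.NumberTheory.Sieve

/-- **FI Proposition 2.1 with hypothesis (2.8) in the form its proof consumes** (named fact). For
a sifted sequence satisfying (2.1)–(2.15) with (2.8) for CUBEFREE moduli `d ≤ x^{1/3}`
(`SieveSequence.FI1998SieveHypothesesCubefree`) together with the divisor cube moment (2.8′)
(`SieveSequence.FI1998DivisorCubeMoment`), in the working regime `δ = (log x)^α`, `Δ = x^θ`
(`α > 0`, `0 < θ < 1/3`) of `FriedlanderIwaniec1998_prop21`: (2.16)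
`S(x) = ∑_{p ≤ x} a_p log p = H A(x) {1 + O(log log x / log x)}`, (2.17)
`H = ∏_p (1 - g(p))(1 - 1/p)⁻¹`. RELATION TO THE PRINTED STATEMENT, recorded deliberately: FI print
Proposition 2.1 with (2.8) for all `d ≤ x^{1/3}` ([FriedlanderIwaniecASP1998] Theorem 2 lists
(1.6) likewise); its proof — ASP §2 p. 1047 ((R′), (B′) for `ã = μ²a`: squarefree moduli), §9
p. 1060 ((R′₃): cubefree moduli), §9 p. 1062 (`S₂`: arbitrary moduli, used only through the bound
(2.8′)), §9 p. 1062 ((1.6) for `Ã`: squarefree moduli), §10 pp. 1064–1065 (`W₁`, `W₀`: squarefree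
moduli) — invokes (2.8) only at cubefree moduli and through (2.8′) (quotations in the module
docstring). The printed hypothesis being unsatisfiable for the very sequence the proposition is
applied to (`FriedlanderIwaniec1998_hyp28_false`), this consumed form is the one vendored for the
discharge DAG of parity.S17; its two (2.8)-type hypotheses are theorems for that sequence
(`FriedlanderIwaniec1998_hyp28_cubefree_holds`, `FriedlanderIwaniec1998_hyp28_moment_holds`). The
asymptotic sieve for primes itself is not proved here.
[cite: FriedlanderIwaniecAnnals1998, Proposition 2.1, (2.16)-(2.17); FriedlanderIwaniecASP1998, Theorems 2-3, §§2, 9, 10] -/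
def FriedlanderIwaniec1998_prop21_consumed : Prop :=
  ∀ (A : SieveSequence) (D P : ℝ → ℝ) (α θ H : ℝ), 0 < α → 0 < θ → θ < 1 / 3 →
    A.FI1998SieveHypothesesCubefree D (fun x => Real.log x ^ α) (fun x => x ^ θ) P →
      A.FI1998DivisorCubeMoment → A.HasDensityConstant H →
      (fun x : ℝ => (∑ p ∈ Nat.primesLE ⌊x⌋₊, A.a p * Real.log p) - H * A.size x) =O[atTop]
        fun x : ℝ => H * A.size x * (Real.log (Real.log x) / Real.log x)

/-- **(2.8′) for `a_n`** (the divisor cube moment of the sequence (4.1),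
`∑_{n ≤ x} a_n τ(n)³ ≪ A(x)(log x)^{2⁸3⁹}`, i.e. the bound for `S₂` of [FriedlanderIwaniecASP1998]
§9 p. 1062 for this sequence); PROVED below (`FriedlanderIwaniec1998_hyp28_moment_holds`). FI obtain
it from (2.8) via Lemma 2; (2.8) failing for `a_n` at non-cubefree moduli, the proof here goes
through the corrected crude bound `A_d(x) ≪ τ(d)³ f(d) x^{3/4}/d` for all `d` instead.
[cite: FriedlanderIwaniecASP1998, §9 p. 1062 (estimate of S₂), for the sequence (4.1)] -/
def FriedlanderIwaniec1998_hyp28_moment : Prop :=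
  fiSieveSeq.FI1998DivisorCubeMoment

end Literature.NumberTheory.Sieve

namespace Literature.NumberTheory.Sieve.FriedlanderIwaniecPrimes

/-! ### A divisor lemma (ASP Lemma 2 with `k = 3`, integral exponents) -/

/-- Among positive integers `S` there is a subset `T` with `(∏ T)³ ≤ ∏ S` and `#S ≤ 3 #T + 2`
(remove the minimum together with two other elements and recurse). [folklore] -/
theorem exists_subset_prod_pow_three_le (S : Finset ℕ) (hS : ∀ p ∈ S, 1 ≤ p) :
    ∃ T ⊆ S, (∏ p ∈ T, p) ^ 3 ≤ ∏ p ∈ S, p ∧ #S ≤ 3 * #T + 2 := by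
  induction S using Finset.strongInduction with
  | H S ih =>
    by_cases h3 : #S < 3
    · refine ⟨∅, empty_subset _, ?_, by simp; omega⟩
      simp only [prod_empty, one_pow]
      exact prod_pos fun p hp => Nat.lt_of_lt_of_le Nat.zero_lt_one (hS p hp)
    · push Not at h3
      have hne : S.Nonempty := card_pos.mp (by omega)
      set p := S.min' hne with hp
      have hpS : p ∈ S := min'_mem S hne
      -- two further elements
      have h2 : 2 ≤ #(S.erase p) := by rw [card_erase_of_mem hpS]; omega
      obtain ⟨q₁, hq₁⟩ : (S.erase p).Nonempty := card_pos.mp (by omega)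
      have h1 : 1 ≤ #((S.erase p).erase q₁) := by rw [card_erase_of_mem hq₁]; omega
      obtain ⟨q₂, hq₂⟩ : ((S.erase p).erase q₁).Nonempty := card_pos.mp (by omega)
      set S' := ((S.erase p).erase q₁).erase q₂ with hS'
      have hS'sub : S' ⊆ S := (erase_subset _ _).trans ((erase_subset _ _).trans (erase_subset _ _))
      have hS'ss : S' ⊂ S := Finset.ssubset_iff_subset_ne.mpr ⟨hS'sub, fun h => by
        have := card_erase_of_mem hq₂; rw [← hS', h] at this
        have := card_erase_of_mem hq₁; have := card_erase_of_mem hpS; omega⟩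
      obtain ⟨T', hT'S', hT'prod, hT'card⟩ := ih S' hS'ss fun p hp => hS p (hS'sub hp)
      have hq₁S : q₁ ∈ S := mem_of_mem_erase hq₁
      have hq₂S : q₂ ∈ S := mem_of_mem_erase (mem_of_mem_erase hq₂)
      have hpq₁ : p ≤ q₁ := min'_le S q₁ hq₁S
      have hpq₂ : p ≤ q₂ := min'_le S q₂ hq₂S
      have hpT' : p ∉ T' := fun h => by
        have := hT'S' h
        simp [hS', mem_erase] at this
      refine ⟨insert p T', ?_, ?_, ?_⟩
      · exact insert_subset hpS (hT'S'.trans hS'sub)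
      · rw [prod_insert hpT', mul_pow]
        -- `∏ S = p q₁ q₂ ∏ S'`
        have hprod : ∏ x ∈ S, x = p * (q₁ * (q₂ * ∏ x ∈ S', x)) := by
          rw [← mul_prod_erase S (fun x => x) hpS, ← mul_prod_erase _ (fun x => x) hq₁,
            ← mul_prod_erase _ (fun x => x) hq₂]
        rw [hprod]
        have hp1 : 1 ≤ p := hS p hpS
        calc p ^ 3 * (∏ x ∈ T', x) ^ 3 = p * (p * (p * (∏ x ∈ T', x) ^ 3)) := by ring
          _ ≤ p * (q₁ * (q₂ * ∏ x ∈ S', x)) := by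
              gcongr
      · rw [card_insert_of_notMem hpT']
        have : #S = #S' + 3 := by
          have e1 := card_erase_of_mem hpS
          have e2 := card_erase_of_mem hq₁
          have e3 := card_erase_of_mem hq₂
          rw [← hS'] at e3
          omega
        omega

/-- `τ` of a product of distinct prime powers: `τ(∏_{p ∈ U} p^{c_p}) = ∏_{p ∈ U} (c_p + 1)`.
[folklore] -/
theorem card_divisors_prod_prime_pow (U : Finset ℕ) (hU : ∀ p ∈ U, p.Prime) (c : ℕ → ℕ) :
    #(∏ p ∈ U, p ^ c p).divisors = ∏ p ∈ U, (c p + 1) := by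
  induction U using Finset.induction_on with
  | empty => simp
  | insert p U hpU ih =>
    have hp : p.Prime := hU p (mem_insert_self p U)
    have hU' : ∀ q ∈ U, q.Prime := fun q hq => hU q (mem_insert_of_mem hq)
    rw [prod_insert hpU, prod_insert hpU]
    have hcop : (p ^ c p).Coprime (∏ q ∈ U, q ^ c q) := by
      refine Nat.Coprime.prod_right fun q hq => ?_
      have hpq : p ≠ q := fun h => hpU (h ▸ hq)
      exact ((Nat.coprime_primes hp (hU' q hq)).mpr hpq).pow _ _
    rw [Nat.Coprime.card_divisors_mul hcop, ih hU', ← ArithmeticFunction.sigma_zero_apply,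
      ArithmeticFunction.sigma_zero_apply_prime_pow hp]

/-- `(q + 1)³ ≥ F + 1` for `q = ⌊F/3⌋`, `F ≥ 3`. [folklore] -/
theorem succ_le_div_three_succ_pow {F : ℕ} (hF : 3 ≤ F) : F + 1 ≤ (F / 3 + 1) ^ 3 := by
  set q := F / 3 with hq
  have hq1 : 1 ≤ q := Nat.le_div_iff_mul_le (by norm_num) |>.mpr (by omega)
  have hF' : F < 3 * (q + 1) := by omega
  nlinarith [hq1, sq_nonneg (q : ℕ)]

/-- **Divisor lemma** (ASP Lemma 2 with `k = 3`, integral exponents): every `n ≥ 1` has a divisor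
`d` with `d³ ≤ n` and `τ(n) ≤ (2τ(d))⁵`. Construction: `d = ∏_{p^F ∥ n, F ≥ 3} p^{⌊F/3⌋} · ∏_{p ∈ T} p`
with `T` a set of primes of exponent `≤ 2` given by `exists_subset_prod_pow_three_le`.
[cite: FriedlanderIwaniecASP1998, §9 Lemma 2 (k = 3)] -/
theorem exists_divisor_card_divisors_le (n : ℕ) (hn : n ≠ 0) :
    ∃ d : ℕ, d ∣ n ∧ d ^ 3 ≤ n ∧ #n.divisors ≤ (2 * #d.divisors) ^ 5 := by
  set F := n.factorization with hF
  set P := n.primeFactors with hP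
  set L := P.filter fun p => 3 ≤ F p with hL
  set S := P.filter fun p => ¬3 ≤ F p with hS
  have hPprime : ∀ p ∈ P, p.Prime := fun p hp => Nat.prime_of_mem_primeFactors hp
  have hFpos : ∀ p ∈ P, F p ≠ 0 := fun p hp =>
    Finsupp.mem_support_iff.mp (by rwa [hF, Nat.support_factorization])
  -- the subset `T ⊆ S`
  obtain ⟨T, hTS, hTprod, hTcard⟩ := exists_subset_prod_pow_three_le S fun p hp =>
    (hPprime p (mem_of_mem_filter p hp)).one_le
  -- exponents and `d`
  set c : ℕ → ℕ := fun p => if 3 ≤ F p then F p / 3 else 1 with hc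
  have hLT : Disjoint L T := by
    refine disjoint_left.mpr fun p hpL hpT => ?_
    exact (mem_filter.mp (hTS hpT)).2 (mem_filter.mp hpL).2
  set U := L ∪ T with hU
  have hUP : U ⊆ P := union_subset (filter_subset _ _) (hTS.trans (filter_subset _ _))
  set d := ∏ p ∈ U, p ^ c p with hd
  have hn_eq : n = ∏ p ∈ P, p ^ F p := by
    conv_lhs => rw [← Nat.prod_factorization_pow_eq_self hn]
    rfl
  have hcle : ∀ p ∈ P, c p ≤ F p := by
    intro p hp
    simp only [hc]
    split_ifs with h
    · exact Nat.div_le_self _ _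
    · exact Nat.one_le_iff_ne_zero.mpr (hFpos p hp)
  refine ⟨d, ?_, ?_, ?_⟩
  · -- `d ∣ n`
    rw [hn_eq]
    calc d ∣ ∏ p ∈ U, p ^ F p :=
          prod_dvd_prod_of_dvd _ _ fun p hp => pow_dvd_pow p (hcle p (hUP hp))
      _ ∣ ∏ p ∈ P, p ^ F p := prod_dvd_prod_of_subset _ _ _ hUP
  · -- `d³ ≤ n`
    have hsplit : (∏ p ∈ L, p ^ F p) * ∏ p ∈ S, p ^ F p = n := by
      rw [hn_eq, hL, hS]; exact prod_filter_mul_prod_filter_not P _ _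
    have h1 : (∏ p ∈ L, p ^ c p) ^ 3 ≤ ∏ p ∈ L, p ^ F p := by
      rw [← prod_pow]
      refine prod_le_prod' fun p hp => ?_
      rw [← pow_mul]
      refine Nat.pow_le_pow_right (hPprime p (mem_of_mem_filter p hp)).pos ?_
      have : 3 ≤ F p := (mem_filter.mp hp).2
      simp only [hc, if_pos this]
      omega
    have h2 : (∏ p ∈ T, p ^ c p) ^ 3 ≤ ∏ p ∈ S, p ^ F p := by
      have hT1 : ∏ p ∈ T, p ^ c p = ∏ p ∈ T, p := by
        refine prod_congr rfl fun p hp => ?_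
        have : ¬3 ≤ F p := (mem_filter.mp (hTS hp)).2
        simp only [hc, if_neg this, pow_one]
      rw [hT1]
      refine hTprod.trans (prod_le_prod' fun p hp => ?_)
      exact Nat.le_self_pow (hFpos p (mem_of_mem_filter p hp)) p
    calc d ^ 3 = (∏ p ∈ L, p ^ c p) ^ 3 * (∏ p ∈ T, p ^ c p) ^ 3 := by
          rw [hd, hU, prod_union hLT, mul_pow]
      _ ≤ (∏ p ∈ L, p ^ F p) * ∏ p ∈ S, p ^ F p := Nat.mul_le_mul h1 h2
      _ = n := hsplit
  · -- `τ(n) ≤ (2 τ(d))⁵`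
    have hτn : #n.divisors = (∏ p ∈ L, (F p + 1)) * ∏ p ∈ S, (F p + 1) := by
      rw [Nat.card_divisors hn, hL, hS]
      exact (prod_filter_mul_prod_filter_not P _ _).symm
    have hτd : #d.divisors = (∏ p ∈ L, (F p / 3 + 1)) * 2 ^ #T := by
      rw [hd, card_divisors_prod_prime_pow U (fun p hp => hPprime p (hUP hp)) c, hU,
        prod_union hLT]
      congr 1
      · refine prod_congr rfl fun p hp => ?_
        have : 3 ≤ F p := (mem_filter.mp hp).2
        simp only [hc, if_pos this]
      · rw [← prod_const]
        refine prod_congr rfl fun p hp => ?_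
        have : ¬3 ≤ F p := (mem_filter.mp (hTS hp)).2
        simp only [hc, if_neg this]
    set A := ∏ p ∈ L, (F p / 3 + 1) with hA
    have hA1 : 1 ≤ A := by
      rw [hA]; exact Nat.one_le_iff_ne_zero.mpr (prod_ne_zero_iff.mpr fun p _ => Nat.succ_ne_zero _)
    have hL3 : ∏ p ∈ L, (F p + 1) ≤ A ^ 3 := by
      rw [hA, ← prod_pow]
      exact prod_le_prod' fun p hp => succ_le_div_three_succ_pow (mem_filter.mp hp).2
    have hS3 : ∏ p ∈ S, (F p + 1) ≤ 3 ^ #S := by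
      rw [← prod_const]
      refine prod_le_prod' fun p hp => ?_
      have : ¬3 ≤ F p := (mem_filter.mp hp).2
      omega
    have h27 : 3 ^ #S ≤ 9 * 27 ^ #T := by
      calc 3 ^ #S ≤ 3 ^ (3 * #T + 2) := Nat.pow_le_pow_right (by norm_num) hTcard
        _ = 9 * 27 ^ #T := by rw [pow_add, pow_mul]; ring
    rw [hτn, hτd]
    calc (∏ p ∈ L, (F p + 1)) * ∏ p ∈ S, (F p + 1) ≤ A ^ 3 * (9 * 27 ^ #T) :=
          Nat.mul_le_mul hL3 (hS3.trans h27)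
      _ ≤ A ^ 5 * (32 * 32 ^ #T) := by
          apply Nat.mul_le_mul (Nat.pow_le_pow_right hA1 (by norm_num))
          exact Nat.mul_le_mul (by norm_num) (Nat.pow_le_pow_left (by norm_num) _)
      _ = (2 * (A * 2 ^ #T)) ^ 5 := by
          rw [show (32 : ℕ) = 2 ^ 5 by norm_num, ← pow_mul, show 5 * #T = #T * 5 by ring, pow_mul]
          ring


/-! ## Divisor cube moment: `∑_{n ≤ x} a_n τ(n)³ ≪ A(x) (log x)^{2^18}` -/

/-! ### Square roots modulo prime powers -/

/-- If `p^k ∣ u v` for a prime `p` then `p^a ∣ u`, `p^b ∣ v` for some `a + b = k`. [folklore] -/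
theorem exists_pow_dvd_of_pow_dvd_mul {p : ℤ} (hp : Prime p) :
    ∀ (k : ℕ) (u v : ℤ), p ^ k ∣ u * v → ∃ a b : ℕ, a + b = k ∧ p ^ a ∣ u ∧ p ^ b ∣ v := by
  intro k
  induction k with
  | zero => intro u v _; exact ⟨0, 0, rfl, by simp, by simp⟩
  | succ k ih =>
    intro u v h
    have hp1 : p ∣ u * v := (dvd_pow_self p (Nat.succ_ne_zero k)).trans h
    rcases hp.dvd_or_dvd hp1 with hu | hv
    · obtain ⟨u', rfl⟩ := hu
      have h' : p ^ k ∣ u' * v := by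
        rw [pow_succ'] at h
        have : p * p ^ k ∣ p * (u' * v) := by rw [← mul_assoc]; exact h
        exact (mul_dvd_mul_iff_left hp.ne_zero).mp this
      obtain ⟨a, b, hab, ha, hb⟩ := ih u' v h'
      exact ⟨a + 1, b, by omega, by rw [pow_succ']; exact mul_dvd_mul_left p ha, hb⟩
    · obtain ⟨v', rfl⟩ := hv
      have h' : p ^ k ∣ u * v' := by
        rw [pow_succ'] at h
        have : p * p ^ k ∣ p * (u * v') := by
          rw [show u * (p * v') = p * (u * v') by ring] at h; exact h
        exact (mul_dvd_mul_iff_left hp.ne_zero).mp this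
      obtain ⟨a, b, hab, ha, hb⟩ := ih u v' h'
      exact ⟨a, b + 1, by omega, ha, by rw [pow_succ']; exact mul_dvd_mul_left p hb⟩

/-- `#{ν ∈ [0, p^k) : p^m ∣ ν - c} ≤ p^{k-m}` for `m ≤ k` (`ν ↦ ν / p^m` is injective on a residue
class mod `p^m`). [folklore] -/
theorem card_range_filter_pow_dvd_sub_le {p : ℕ} (hp : 0 < p) {k m : ℕ} (hmk : m ≤ k) (c : ℤ) :
    #((range (p ^ k)).filter fun ν : ℕ => ((p : ℤ) ^ m) ∣ (ν : ℤ) - c) ≤ p ^ (k - m) := by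
  have hpm : 0 < p ^ m := pow_pos hp m
  calc _ ≤ #(range (p ^ (k - m))) := ?_
    _ = p ^ (k - m) := card_range _
  refine card_le_card_of_injOn (fun ν => ν / p ^ m) ?_ ?_
  · intro ν hν
    have hνr := mem_range.mp (mem_filter.mp (mem_coe.mp hν)).1
    rw [mem_coe, mem_range]
    apply Nat.div_lt_of_lt_mul
    rwa [← pow_add, add_comm, Nat.sub_add_cancel hmk]
  · intro ν hν ν' hν' h
    have h1 := (mem_filter.mp (mem_coe.mp hν)).2
    have h2 := (mem_filter.mp (mem_coe.mp hν')).2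
    simp only at h
    have hmod : ν % p ^ m = ν' % p ^ m := by
      have hd : ((p ^ m : ℕ) : ℤ) ∣ (ν' : ℤ) - ν := by
        have := h2.sub h1
        have e : (ν' : ℤ) - c - ((ν : ℤ) - c) = (ν' : ℤ) - ν := by ring
        rw [e] at this; exact_mod_cast this
      have hm : (ν : ℤ) % ((p ^ m : ℕ) : ℤ) = (ν' : ℤ) % ((p ^ m : ℕ) : ℤ) :=
        Int.modEq_iff_dvd.mpr hd
      exact_mod_cast hm
    calc ν = p ^ m * (ν / p ^ m) + ν % p ^ m := (Nat.div_add_mod ν (p ^ m)).symm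
      _ = p ^ m * (ν' / p ^ m) + ν' % p ^ m := by rw [h, hmod]
      _ = ν' := Nat.div_add_mod ν' (p ^ m)

/-- **Prime powers**: `N(p^k, t) ≤ (k + 1) p^{⌊k/2⌋}` for every `t`. Two roots `ν, ν₀` have
`p^k ∣ (ν - ν₀)(ν + ν₀)`, so `p^a ∣ ν - ν₀` and `p^{k-a} ∣ ν + ν₀` for some `0 ≤ a ≤ k`
(`exists_pow_dvd_of_pow_dvd_mul`), which leaves `≤ p^{min(a, k-a)} ≤ p^{⌊k/2⌋}` values of `ν`
(`card_range_filter_pow_dvd_sub_le`). [folklore] -/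
theorem sqCongrCount_prime_pow_le {p : ℕ} (hp : p.Prime) (k : ℕ) (t : ℤ) :
    sqCongrCount (p ^ k) t ≤ (k + 1) * p ^ (k / 2) := by
  unfold sqCongrCount
  set S := (range (p ^ k)).filter fun ν : ℕ => ((p ^ k : ℕ) : ℤ) ∣ (ν : ℤ) ^ 2 - t with hS_def
  rcases S.eq_empty_or_nonempty with hS0 | ⟨ν₀, hν₀⟩
  · rw [hS0, card_empty]; exact Nat.zero_le _
  have hpI : Prime (p : ℤ) := Nat.prime_iff_prime_int.mp hp
  have h0 := (mem_filter.mp hν₀).2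
  set T : ℕ → Finset ℕ := fun a => (range (p ^ k)).filter fun ν : ℕ =>
      (p : ℤ) ^ a ∣ (ν : ℤ) - ν₀ ∧ (p : ℤ) ^ (k - a) ∣ (ν : ℤ) + ν₀ with hT_def
  have hcover : S ⊆ (range (k + 1)).biUnion T := by
    intro ν hν
    obtain ⟨hνr, hν⟩ := mem_filter.mp hν
    have hprod : (p : ℤ) ^ k ∣ ((ν : ℤ) - ν₀) * ((ν : ℤ) + ν₀) := by
      have := hν.sub h0
      have e : (ν : ℤ) ^ 2 - t - ((ν₀ : ℤ) ^ 2 - t) = ((ν : ℤ) - ν₀) * ((ν : ℤ) + ν₀) := by ring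
      rw [e] at this; exact_mod_cast this
    obtain ⟨a, b, hab, ha, hb⟩ := exists_pow_dvd_of_pow_dvd_mul hpI k _ _ hprod
    rw [mem_biUnion]
    refine ⟨a, mem_range.mpr (by omega), mem_filter.mpr ⟨hνr, ha, ?_⟩⟩
    rwa [show k - a = b by omega]
  have hcardT : ∀ a ∈ range (k + 1), #(T a) ≤ p ^ (k / 2) := by
    intro a ha
    have hak : a ≤ k := Nat.lt_succ_iff.mp (mem_range.mp ha)
    by_cases hcase : a ≤ k / 2
    · -- use the second congruence: `p^{k-a} ∣ ν - (-ν₀)`, `≤ p^a` values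
      calc #(T a) ≤ #((range (p ^ k)).filter fun ν : ℕ => (p : ℤ) ^ (k - a) ∣ (ν : ℤ) - (-ν₀)) := by
            refine card_le_card fun ν hν => ?_
            obtain ⟨hνr, -, h2⟩ := mem_filter.mp hν
            exact mem_filter.mpr ⟨hνr, by rwa [sub_neg_eq_add]⟩
        _ ≤ p ^ (k - (k - a)) := card_range_filter_pow_dvd_sub_le hp.pos (Nat.sub_le k a) _
        _ ≤ p ^ (k / 2) := Nat.pow_le_pow_right hp.pos (by omega)
    · calc #(T a) ≤ #((range (p ^ k)).filter fun ν : ℕ => (p : ℤ) ^ a ∣ (ν : ℤ) - ν₀) :=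
            card_le_card fun ν hν => by
              obtain ⟨hνr, h1, -⟩ := mem_filter.mp hν
              exact mem_filter.mpr ⟨hνr, h1⟩
        _ ≤ p ^ (k - a) := card_range_filter_pow_dvd_sub_le hp.pos hak _
        _ ≤ p ^ (k / 2) := Nat.pow_le_pow_right hp.pos (by omega)
  calc #S ≤ #((range (k + 1)).biUnion T) := card_le_card hcover
    _ ≤ ∑ a ∈ range (k + 1), #(T a) := card_biUnion_le
    _ ≤ ∑ a ∈ range (k + 1), p ^ (k / 2) := sum_le_sum hcardT
    _ = (k + 1) * p ^ (k / 2) := by rw [sum_const, card_range, smul_eq_mul]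

/-! ### The loss factor `f(d) = ∏_{p^k ∥ d, k ≥ 3} p^{⌊k/2⌋}` and the root count for all moduli -/

/-- The loss factor at moduli that are not cubefree: `f(d) = ∏_{p^k ∥ d, k ≥ 3} p^{⌊k/2⌋}`
(`= 1` for cubefree `d`; `f(p⁴) = p²` accounts for the singular solutions `p² ∣ a`, `p ∣ c` of
`FriedlanderIwaniec1998_hyp28_false`). [folklore] -/
def fiLoss (d : ℕ) : ℕ := d.factorization.prod fun p k => if 3 ≤ k then p ^ (k / 2) else 1

/-- `f(1) = 1`. [folklore] -/
theorem fiLoss_one : fiLoss 1 = 1 := by simp [fiLoss]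

/-- `f(p^k) = p^{⌊k/2⌋}` if `k ≥ 3`, else `1`. [folklore] -/
theorem fiLoss_prime_pow {p : ℕ} (hp : p.Prime) (k : ℕ) :
    fiLoss (p ^ k) = if 3 ≤ k then p ^ (k / 2) else 1 := by
  rw [fiLoss, hp.factorization_pow, Finsupp.prod_single_index (by simp)]

/-- `f` is multiplicative on coprime arguments. [folklore] -/
theorem fiLoss_mul {a b : ℕ} (ha : a ≠ 0) (hb : b ≠ 0) (hab : a.Coprime b) :
    fiLoss (a * b) = fiLoss a * fiLoss b := by
  unfold fiLoss
  rw [Nat.factorization_mul ha hb, Finsupp.prod_add_index_of_disjoint]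
  rw [Nat.support_factorization, Nat.support_factorization]
  exact hab.disjoint_primeFactors

/-- `f(d) ≥ 1`. [folklore] -/
theorem one_le_fiLoss (d : ℕ) : 1 ≤ fiLoss d := by
  unfold fiLoss Finsupp.prod
  refine Nat.one_le_iff_ne_zero.mpr (prod_ne_zero_iff.mpr fun p hp => ?_)
  have hp' : p.Prime := Nat.prime_of_mem_primeFactors (by rwa [Nat.support_factorization] at hp)
  show (if 3 ≤ d.factorization p then p ^ (d.factorization p / 2) else 1) ≠ 0
  split_ifs
  · exact pow_ne_zero _ hp'.ne_zero
  · exact one_ne_zero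

/-- **Root count for all moduli**: for `d ≥ 1` and every `c` there is `g` with `g ∣ c`, `g² ∣ d` and
`N(d, -c⁴) ≤ τ(d)² f(d) g` (prime powers `p`, `p²` as in `sqCongrCount_cubefree_le`, higher prime
powers by `sqCongrCount_prime_pow_le`). [folklore] -/
theorem sqCongrCount_le_general (c : ℤ) :
    ∀ d : ℕ, d ≠ 0 →
      ∃ g : ℕ, g ∣ c.natAbs ∧ g ^ 2 ∣ d ∧
        sqCongrCount d (-c ^ 4) ≤ #d.divisors ^ 2 * fiLoss d * g := by
  intro d
  induction d using Nat.recOnPosPrimePosCoprime with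
  | zero => intro h; exact absurd rfl h
  | one =>
    intro _
    exact ⟨1, one_dvd _, by norm_num, by simpa [fiLoss_one] using sqCongrCount_one (-c ^ 4)⟩
  | prime_pow p k hp hk =>
    intro _
    rw [card_divisors_prime_pow hp, fiLoss_prime_pow hp]
    rcases Nat.lt_or_ge k 3 with hk3 | hk3
    · rw [if_neg (by omega)]
      interval_cases k
      · -- `d = p`
        refine ⟨1, one_dvd _, by norm_num, ?_⟩
        rw [pow_one]
        have := sqCongrCount_prime_le hp (-c ^ 4)
        omega
      · -- `d = p²`
        by_cases hpc : (p : ℤ) ∣ c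
        · refine ⟨p, Int.natCast_dvd.mp hpc, dvd_rfl, ?_⟩
          have := sqCongrCount_prime_sq_le_of_dvd hp hpc
          nlinarith
        · refine ⟨1, one_dvd _, by norm_num, ?_⟩
          by_cases hp2 : p = 2
          · subst hp2
            have := sqCongrCount_le (2 ^ 2) (-c ^ 4)
            norm_num at this ⊢
            omega
          · have := sqCongrCount_prime_sq_le_two hp hp2 hpc
            omega
    · -- `d = p^k`, `k ≥ 3`
      rw [if_pos hk3]
      refine ⟨1, one_dvd _, by norm_num, ?_⟩
      have := sqCongrCount_prime_pow_le hp k (-c ^ 4)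
      calc sqCongrCount (p ^ k) (-c ^ 4) ≤ (k + 1) * p ^ (k / 2) := this
        _ ≤ (k + 1) ^ 2 * p ^ (k / 2) * 1 := by
            rw [mul_one]; exact Nat.mul_le_mul_right _ (by nlinarith)
  | coprime a b ha hb hab iha ihb =>
    intro _
    have ha0 : a ≠ 0 := by omega
    have hb0 : b ≠ 0 := by omega
    obtain ⟨ga, hga1, hga2, hga3⟩ := iha ha0
    obtain ⟨gb, hgb1, hgb2, hgb3⟩ := ihb hb0
    refine ⟨ga * gb, ?_, ?_, ?_⟩
    · have hga : ga ∣ a := (Dvd.intro_left _ (sq ga).symm).trans hga2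
      have hgb : gb ∣ b := (Dvd.intro_left _ (sq gb).symm).trans hgb2
      have hcop : ga.Coprime gb := (hab.coprime_dvd_left hga).coprime_dvd_right hgb
      exact hcop.mul_dvd_of_dvd_of_dvd hga1 hgb1
    · rw [mul_pow]; exact mul_dvd_mul hga2 hgb2
    · calc sqCongrCount (a * b) (-c ^ 4)
          ≤ sqCongrCount a (-c ^ 4) * sqCongrCount b (-c ^ 4) :=
            sqCongrCount_mul_le (by omega) (by omega) hab _
        _ ≤ (#a.divisors ^ 2 * fiLoss a * ga) * (#b.divisors ^ 2 * fiLoss b * gb) :=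
            Nat.mul_le_mul hga3 hgb3
        _ = #(a * b).divisors ^ 2 * fiLoss (a * b) * (ga * gb) := by
            rw [Nat.Coprime.card_divisors_mul hab, fiLoss_mul ha0 hb0 hab]; ring

/-- **The crude bound for all moduli, combinatorial form**: for `d ≥ 1`,
`A_d(x) ≤ (2√X/d + 1) τ(d)² f(d) · τ(d) (2X^{1/4} + √d)` (`X = ⌊x⌋`). [folklore] -/
theorem congrSum_le_general {d : ℕ} (hd : 0 < d) (x : ℝ) :
    fiSieveSeq.congrSum d x ≤
      ((2 * Nat.sqrt ⌊x⌋₊ / d + 1 : ℕ) : ℝ) * ((#d.divisors : ℝ) ^ 2 * fiLoss d) *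
        ((#d.divisors : ℝ) * (2 * Nat.sqrt (Nat.sqrt ⌊x⌋₊) + Nat.sqrt d)) := by
  set R := Nat.sqrt ⌊x⌋₊
  set M := Nat.sqrt (Nat.sqrt ⌊x⌋₊)
  have hex := fun c : ℤ => sqCongrCount_le_general c d hd.ne'
  choose g hg using hex
  have hnat : #{P ∈ Icc (-(R : ℤ)) R ×ˢ Icc (-(M : ℤ)) M | (d : ℤ) ∣ P.1 ^ 2 + P.2 ^ 4} ≤
      (2 * R / d + 1) * (#d.divisors ^ 2 * fiLoss d) * (#d.divisors * (2 * M + Nat.sqrt d)) := by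
    rw [card_box_filter_eq_sum]
    calc ∑ c ∈ Icc (-(M : ℤ)) M, #{a ∈ Icc (-(R : ℤ)) R | (d : ℤ) ∣ a ^ 2 + c ^ 4}
        ≤ ∑ c ∈ Icc (-(M : ℤ)) M, (2 * R / d + 1) * (#d.divisors ^ 2 * fiLoss d * g c) :=
          sum_le_sum fun c _ => (card_filter_dvd_sq_add_le hd R c).trans
            (Nat.mul_le_mul_left _ (hg c).2.2)
      _ = (2 * R / d + 1) * (#d.divisors ^ 2 * fiLoss d) * ∑ c ∈ Icc (-(M : ℤ)) M, g c := by
          rw [mul_sum]; refine sum_congr rfl fun c _ => ?_; ring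
      _ ≤ (2 * R / d + 1) * (#d.divisors ^ 2 * fiLoss d) * (#d.divisors * (2 * M + Nat.sqrt d)) :=
          Nat.mul_le_mul_left _ (sum_le_of_dvd_of_sq_dvd hd.ne' M g fun c => ⟨(hg c).1, (hg c).2.1⟩)
  calc fiSieveSeq.congrSum d x ≤ _ := congrSum_le_card_box d x
    _ ≤ (((2 * R / d + 1) * (#d.divisors ^ 2 * fiLoss d) * (#d.divisors * (2 * M + Nat.sqrt d)) :
          ℕ) : ℝ) := by exact_mod_cast hnat
    _ = _ := by push_cast; ring

/-- **The crude bound for all moduli**: `A_d(x) ≤ 9 τ(d)³ f(d) x^{3/4} / d` for `1 ≤ d ≤ x^{1/3}`,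
`x ≥ 1` (sharp up to `τ`-powers: `f(p⁴) = p²`... no: `A_{p⁴} ≍ p A(x)/p⁴` while `f(p⁴)/p⁴ = p⁻²`;
the bound is what the uniform root count `N(p^k, t) ≤ (k+1) p^{⌊k/2⌋}` gives). [folklore] -/
theorem congrSum_le_rpow_general {x : ℝ} (hx1 : 1 ≤ x) {d : ℕ} (hd : 1 ≤ d)
    (hdx : (d : ℝ) ≤ x ^ (1 / 3 : ℝ)) :
    fiSieveSeq.congrSum d x ≤ 9 * (#d.divisors : ℝ) ^ 3 * fiLoss d * x ^ (3 / 4 : ℝ) / d := by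
  have hx0 : 0 < x := by linarith
  have hd0 : (0 : ℝ) < d := by exact_mod_cast hd
  set τ : ℝ := (#d.divisors : ℝ) with hτ_def
  have hτ1 : 1 ≤ τ := by rw [hτ_def]; exact_mod_cast one_le_card_divisors (d := d) (by omega)
  have hf1 : (1 : ℝ) ≤ fiLoss d := by exact_mod_cast one_le_fiLoss d
  have h := congrSum_le_general (d := d) (by omega) x
  have hsqrt : ((Nat.sqrt ⌊x⌋₊ : ℕ) : ℝ) ≤ Real.sqrt x := nat_sqrt_floor_le_sqrt hx0.le
  have hdsqrt : (d : ℝ) ≤ Real.sqrt x := by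
    rw [Real.sqrt_eq_rpow]
    exact hdx.trans (Real.rpow_le_rpow_of_exponent_le hx1 (by norm_num))
  have hi : ((2 * Nat.sqrt ⌊x⌋₊ / d + 1 : ℕ) : ℝ) ≤ 3 * Real.sqrt x / d := by
    have h1 : ((2 * Nat.sqrt ⌊x⌋₊ / d : ℕ) : ℝ) ≤ 2 * Real.sqrt x / d := by
      calc ((2 * Nat.sqrt ⌊x⌋₊ / d : ℕ) : ℝ) ≤ ((2 * Nat.sqrt ⌊x⌋₊ : ℕ) : ℝ) / d := Nat.cast_div_le
        _ ≤ 2 * Real.sqrt x / d := by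
            apply div_le_div_of_nonneg_right _ hd0.le
            push_cast; linarith
    have h2 : (1 : ℝ) ≤ Real.sqrt x / d := by rw [le_div_iff₀ hd0, one_mul]; exact hdsqrt
    have h3 : 3 * Real.sqrt x / d = 2 * Real.sqrt x / d + Real.sqrt x / d := by ring
    push_cast at h1 ⊢
    linarith
  have hM := nat_sqrt_sqrt_floor_le_rpow hx0.le
  have hsd : ((Nat.sqrt d : ℕ) : ℝ) ≤ x ^ (1 / 4 : ℝ) := by
    calc ((Nat.sqrt d : ℕ) : ℝ) ≤ Real.sqrt d := Real.nat_sqrt_le_real_sqrt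
      _ ≤ Real.sqrt (x ^ (1 / 3 : ℝ)) := Real.sqrt_le_sqrt hdx
      _ = x ^ (1 / 6 : ℝ) := by
          rw [Real.sqrt_eq_rpow, ← Real.rpow_mul hx0.le]; norm_num
      _ ≤ x ^ (1 / 4 : ℝ) := Real.rpow_le_rpow_of_exponent_le hx1 (by norm_num)
  have hii : (2 * ((Nat.sqrt (Nat.sqrt ⌊x⌋₊) : ℕ) : ℝ) + ((Nat.sqrt d : ℕ) : ℝ)) ≤
      3 * x ^ (1 / 4 : ℝ) := by linarith
  have hx34 : Real.sqrt x * x ^ (1 / 4 : ℝ) = x ^ (3 / 4 : ℝ) := by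
    rw [Real.sqrt_eq_rpow, ← Real.rpow_add hx0]; norm_num
  have hτ0 : 0 ≤ τ := by linarith
  calc fiSieveSeq.congrSum d x
      ≤ ((2 * Nat.sqrt ⌊x⌋₊ / d + 1 : ℕ) : ℝ) * (τ ^ 2 * fiLoss d) *
          (τ * (2 * ((Nat.sqrt (Nat.sqrt ⌊x⌋₊) : ℕ) : ℝ) + ((Nat.sqrt d : ℕ) : ℝ))) := h
    _ ≤ (3 * Real.sqrt x / d) * (τ ^ 2 * fiLoss d) * (τ * (3 * x ^ (1 / 4 : ℝ))) := by
        apply mul_le_mul (mul_le_mul_of_nonneg_right hi (by positivity))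
          (mul_le_mul_of_nonneg_left hii hτ0) (by positivity) (by positivity)
    _ = 9 * τ ^ 3 * fiLoss d * (Real.sqrt x * x ^ (1 / 4 : ℝ)) / d := by ring
    _ = 9 * τ ^ 3 * fiLoss d * x ^ (3 / 4 : ℝ) / d := by rw [hx34]

/-! ### Sums of multiplicative functions over `d ≤ Y` versus Euler products -/

/-- **Sub-Euler-product bound**: for a nonnegative multiplicative `h` with `h(1) = 1`,
`∑_{d ≤ Y} h(d) ≤ ∏_{p ≤ Y} ∑_{k ≤ log₂ Y} h(p^k)` (expand the product and keep the terms indexed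
by the factorisations of the `d ≤ Y`). [folklore] -/
theorem sum_Icc_le_prod_primesLE_sum {h : ℕ → ℝ} (h0 : ∀ n, 0 ≤ h n) (h1 : h 1 = 1)
    (hmul : ∀ a b : ℕ, a.Coprime b → h (a * b) = h a * h b) (Y : ℕ) :
    ∑ d ∈ Icc 1 Y, h d ≤ ∏ p ∈ Nat.primesLE Y, ∑ k ∈ range (Nat.log 2 Y + 1), h (p ^ k) := by
  classical
  set P := Nat.primesLE Y with hP
  set K := Nat.log 2 Y with hK
  rw [Finset.prod_sum P (fun _ => range (K + 1)) fun p k => h (p ^ k)]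
  -- the embedding `d ↦ (p ↦ v_p(d))`
  set φ : ℕ → ((p : ℕ) → p ∈ P → ℕ) := fun d p _ => d.factorization p with hφ
  have hmem : ∀ d ∈ Icc 1 Y, φ d ∈ P.pi fun _ => range (K + 1) := by
    intro d hd
    obtain ⟨hd1, hdY⟩ := mem_Icc.mp hd
    rw [Finset.mem_pi]
    intro p hp
    rw [mem_range, Nat.lt_succ_iff]
    have hp' : p.Prime := (Nat.mem_primesLE.mp hp).2
    refine Nat.le_log_of_pow_le one_lt_two ?_
    calc 2 ^ d.factorization p ≤ p ^ d.factorization p := Nat.pow_le_pow_left hp'.two_le _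
      _ ≤ d := Nat.ordProj_le p (by omega)
      _ ≤ Y := hdY
  have hval : ∀ d ∈ Icc 1 Y,
      ∏ x ∈ P.attach, h (x.1 ^ φ d x.1 x.2) = h d := by
    intro d hd
    obtain ⟨hd1, hdY⟩ := mem_Icc.mp hd
    have hd0 : d ≠ 0 := by omega
    rw [Finset.prod_attach P fun p => h (p ^ d.factorization p)]
    have hsub : d.primeFactors ⊆ P := fun p hp => by
      have := Nat.mem_primeFactors.mp hp
      exact Nat.mem_primesLE.mpr ⟨(Nat.le_of_dvd (by omega) this.2.1).trans hdY, this.1⟩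
    rw [← Finset.prod_subset hsub fun p _ hpd => by
      rw [Nat.factorization_eq_zero_of_not_dvd fun h => hpd
        (Nat.mem_primeFactors.mpr ⟨(Nat.mem_primesLE.mp ‹p ∈ P›).2, h, hd0⟩), pow_zero, h1]]
    rw [Nat.multiplicative_factorization h hmul h1 hd0, Finsupp.prod, Nat.support_factorization]
  have hinj : Set.InjOn φ ↑(Icc 1 Y) := by
    intro d hd d' hd' heq
    obtain ⟨hd1, hdY⟩ := mem_Icc.mp (mem_coe.mp hd)
    obtain ⟨hd1', hdY'⟩ := mem_Icc.mp (mem_coe.mp hd')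
    refine Nat.eq_of_factorization_eq (by omega) (by omega) fun p => ?_
    by_cases hp : p ∈ P
    · exact congrFun (congrFun heq p) hp
    · -- `p` prime `> Y` or not prime: both exponents vanish
      by_cases hpp : p.Prime
      · have hpY : Y < p := by
          by_contra hle; exact hp (Nat.mem_primesLE.mpr ⟨not_lt.mp hle, hpp⟩)
        rw [Nat.factorization_eq_zero_of_not_dvd fun h => by
              have := Nat.le_of_dvd (by omega) h; omega,
            Nat.factorization_eq_zero_of_not_dvd fun h => by
              have := Nat.le_of_dvd (by omega) h; omega]
      · rw [Nat.factorization_eq_zero_of_not_prime _ hpp,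
          Nat.factorization_eq_zero_of_not_prime _ hpp]
  calc ∑ d ∈ Icc 1 Y, h d = ∑ d ∈ Icc 1 Y, ∏ x ∈ P.attach, h (x.1 ^ φ d x.1 x.2) :=
        sum_congr rfl fun d hd => (hval d hd).symm
    _ = ∑ g ∈ (Icc 1 Y).image φ, ∏ x ∈ P.attach, h (x.1 ^ g x.1 x.2) :=
        (sum_image (f := fun g => ∏ x ∈ P.attach, h (x.1 ^ g x.1 x.2)) hinj).symm
    _ ≤ ∑ g ∈ P.pi (fun _ => range (K + 1)), ∏ x ∈ P.attach, h (x.1 ^ g x.1 x.2) := by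
        refine sum_le_sum_of_subset_of_nonneg ?_ fun g _ _ => prod_nonneg fun x _ => h0 _
        intro g hg
        obtain ⟨d, hd, rfl⟩ := mem_image.mp hg
        exact hmem d hd

/-! ### The weight `h(d) = τ(d)^{18} f(d) / d` and its Euler product -/

/-- The weight `h(d) = τ(d)^{18} f(d)/d` of the moment bound. [folklore] -/
def fiMomentWeight (d : ℕ) : ℝ := (#d.divisors : ℝ) ^ 18 * (fiLoss d : ℝ) / d

/-- `h ≥ 0`. [folklore] -/
theorem fiMomentWeight_nonneg (d : ℕ) : 0 ≤ fiMomentWeight d := by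
  unfold fiMomentWeight; positivity

/-- `h(1) = 1`. [folklore] -/
theorem fiMomentWeight_one : fiMomentWeight 1 = 1 := by
  simp [fiMomentWeight, fiLoss_one]

/-- `h(0) = 0` (junk). [folklore] -/
theorem fiMomentWeight_zero : fiMomentWeight 0 = 0 := by
  simp [fiMomentWeight]

/-- `h` is multiplicative on coprime arguments. [folklore] -/
theorem fiMomentWeight_mul (a b : ℕ) (hab : a.Coprime b) :
    fiMomentWeight (a * b) = fiMomentWeight a * fiMomentWeight b := by
  rcases eq_or_ne a 0 with rfl | ha
  · have hb : b = 1 := (Nat.coprime_zero_left b).mp hab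
    subst hb; rw [mul_one, fiMomentWeight_one, mul_one]
  rcases eq_or_ne b 0 with rfl | hb
  · have ha1 : a = 1 := (Nat.coprime_zero_right a).mp hab
    subst ha1; rw [one_mul, fiMomentWeight_one, one_mul]
  unfold fiMomentWeight
  rw [Nat.Coprime.card_divisors_mul hab, fiLoss_mul ha hb hab]
  push_cast
  have ha' : (a : ℝ) ≠ 0 := by exact_mod_cast ha
  have hb' : (b : ℝ) ≠ 0 := by exact_mod_cast hb
  field_simp

/-- `h(p^k) = (k+1)^{18} f(p^k) / p^k`. [folklore] -/
theorem fiMomentWeight_prime_pow {p : ℕ} (hp : p.Prime) (k : ℕ) :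
    fiMomentWeight (p ^ k) =
      ((k : ℝ) + 1) ^ 18 * ((if 3 ≤ k then p ^ (k / 2) else 1 : ℕ) : ℝ) / (p : ℝ) ^ k := by
  rw [fiMomentWeight, card_divisors_prime_pow hp, fiLoss_prime_pow hp]
  push_cast
  ring

/-- The summable series `∑_k (k+1)^{18} 2^{-k/2}` controlling the prime powers `p^k`, `k ≥ 3`.
[folklore] -/
def fiMomentSeries (k : ℕ) : ℝ := ((k : ℝ) + 1) ^ 18 * ((Real.sqrt 2)⁻¹) ^ k

/-- `∑_k (k+1)^{18} 2^{-k/2} < ∞`. [folklore] -/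
theorem summable_fiMomentSeries : Summable fiMomentSeries := by
  have hr : ‖(Real.sqrt 2)⁻¹‖ < 1 := by
    rw [Real.norm_eq_abs, abs_of_pos (by positivity)]
    refine inv_lt_one_of_one_lt₀ ?_
    rw [show (1 : ℝ) = Real.sqrt 1 by simp]
    exact Real.sqrt_lt_sqrt zero_le_one one_lt_two
  have h := summable_pow_mul_geometric_of_norm_lt_one 18 hr
  have h1 := (summable_nat_add_iff 1).mpr h
  have h2 := h1.mul_left (Real.sqrt 2)
  refine h2.congr fun k => ?_
  unfold fiMomentSeries
  have hs : Real.sqrt 2 ≠ 0 := by positivity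
  simp only [Nat.cast_add, Nat.cast_one]
  rw [pow_succ (Real.sqrt 2)⁻¹ k]
  field_simp

/-- `fiMomentSeries ≥ 0`. [folklore] -/
theorem fiMomentSeries_nonneg (k : ℕ) : 0 ≤ fiMomentSeries k := by
  unfold fiMomentSeries; positivity

/-- The constant `E₁ = ∑_k (k+1)^{18} 2^{-k/2}`. [folklore] -/
def fiMomentConst : ℝ := ∑' k : ℕ, fiMomentSeries k

/-- `E₁ ≥ 0`. [folklore] -/
theorem fiMomentConst_nonneg : 0 ≤ fiMomentConst :=
  tsum_nonneg fiMomentSeries_nonneg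

/-- For `k ≥ 3` and `p ≥ 2`: `p^{⌊k/2⌋} / p^k ≤ 4 · 2^{-k/2} / p²`. [folklore] -/
theorem pow_div_two_div_pow_le {p : ℕ} (hp : 2 ≤ p) {k : ℕ} (hk : 3 ≤ k) :
    ((p ^ (k / 2) : ℕ) : ℝ) / (p : ℝ) ^ k ≤ 4 * ((Real.sqrt 2)⁻¹) ^ k / (p : ℝ) ^ 2 := by
  have hp0 : (0 : ℝ) < p := by exact_mod_cast (by omega : 0 < p)
  have hp2 : (2 : ℝ) ≤ p := by exact_mod_cast hp
  set m := k - k / 2 with hm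
  have h2m : k ≤ 2 * m := by omega
  have hm2 : 2 ≤ m := by omega
  -- `p^k = p^{k/2} p^m`
  have hsplit : (p : ℝ) ^ k = (p : ℝ) ^ (k / 2) * (p : ℝ) ^ m := by
    rw [← pow_add]; congr 1; omega
  -- `p^m ≥ p² 2^{m-2}` and `(√2)^k ≤ 2^m`
  have hpm : (p : ℝ) ^ 2 * 2 ^ (m - 2) ≤ (p : ℝ) ^ m := by
    calc (p : ℝ) ^ 2 * 2 ^ (m - 2) ≤ (p : ℝ) ^ 2 * (p : ℝ) ^ (m - 2) := by
          gcongr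
      _ = (p : ℝ) ^ m := by rw [← pow_add]; congr 1; omega
  have hsqrt : (Real.sqrt 2) ^ k ≤ (2 : ℝ) ^ m := by
    have h1 : (Real.sqrt 2) ^ k ≤ (Real.sqrt 2) ^ (2 * m) :=
      pow_le_pow_right₀ (Real.one_le_sqrt.mpr one_le_two) h2m
    calc (Real.sqrt 2) ^ k ≤ (Real.sqrt 2) ^ (2 * m) := h1
      _ = ((Real.sqrt 2) ^ 2) ^ m := by rw [pow_mul]
      _ = 2 ^ m := by rw [Real.sq_sqrt zero_le_two]
  have hs0 : 0 < Real.sqrt 2 := by positivity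
  rw [inv_pow, div_le_div_iff₀ (by positivity) (by positivity)]
  push_cast
  rw [hsplit]
  -- goal: p^{k/2} * p² ≤ 4 * ((√2)^k)⁻¹ * (p^{k/2} * p^m)
  have hpk2 : (0 : ℝ) < (p : ℝ) ^ (k / 2) := by positivity
  have key : (p : ℝ) ^ 2 ≤ 4 * ((Real.sqrt 2) ^ k)⁻¹ * (p : ℝ) ^ m := by
    rw [show (4 : ℝ) * ((Real.sqrt 2) ^ k)⁻¹ * (p : ℝ) ^ m = 4 * (p : ℝ) ^ m / (Real.sqrt 2) ^ k by
      ring]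
    rw [le_div_iff₀ (by positivity)]
    calc (p : ℝ) ^ 2 * (Real.sqrt 2) ^ k ≤ (p : ℝ) ^ 2 * 2 ^ m := by gcongr
      _ = 4 * ((p : ℝ) ^ 2 * 2 ^ (m - 2)) := by
          rw [show (2 : ℝ) ^ m = 2 ^ 2 * 2 ^ (m - 2) by rw [← pow_add]; congr 1; omega]; ring
      _ ≤ 4 * (p : ℝ) ^ m := by linarith
  calc ((p : ℝ) ^ (k / 2)) * (p : ℝ) ^ 2
      ≤ (p : ℝ) ^ (k / 2) * (4 * ((Real.sqrt 2) ^ k)⁻¹ * (p : ℝ) ^ m) :=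
        mul_le_mul_of_nonneg_left key hpk2.le
    _ = 4 * ((Real.sqrt 2) ^ k)⁻¹ * ((p : ℝ) ^ (k / 2) * (p : ℝ) ^ m) := by ring

/-- **The local factor**: `∑_{k < N} h(p^k) ≤ 1 + 2^{18}/p + (3^{18} + 4E₁)/p²`. [folklore] -/
theorem sum_fiMomentWeight_prime_pow_le {p : ℕ} (hp : p.Prime) (N : ℕ) :
    ∑ k ∈ range N, fiMomentWeight (p ^ k) ≤
      1 + 2 ^ 18 / (p : ℝ) + (3 ^ 18 + 4 * fiMomentConst) / (p : ℝ) ^ 2 := by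
  have hp0 : (0 : ℝ) < p := by exact_mod_cast hp.pos
  have hmono : ∑ k ∈ range N, fiMomentWeight (p ^ k) ≤
      ∑ k ∈ range (max N 3), fiMomentWeight (p ^ k) :=
    sum_le_sum_of_subset_of_nonneg (range_subset_range.mpr (le_max_left _ _))
      fun k _ _ => fiMomentWeight_nonneg _
  refine hmono.trans ?_
  rw [← sum_range_add_sum_Ico _ (le_max_right N 3)]
  -- the first three terms
  have h3 : ∑ k ∈ range 3, fiMomentWeight (p ^ k) =
      1 + 2 ^ 18 / (p : ℝ) + 3 ^ 18 / (p : ℝ) ^ 2 := by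
    rw [sum_range_succ, sum_range_succ, sum_range_one, pow_zero, fiMomentWeight_one,
      fiMomentWeight_prime_pow hp 1, fiMomentWeight_prime_pow hp 2]
    norm_num
  -- the tail
  have htail : ∑ k ∈ Ico 3 (max N 3), fiMomentWeight (p ^ k) ≤ 4 * fiMomentConst / (p : ℝ) ^ 2 := by
    calc ∑ k ∈ Ico 3 (max N 3), fiMomentWeight (p ^ k)
        ≤ ∑ k ∈ Ico 3 (max N 3), 4 / (p : ℝ) ^ 2 * fiMomentSeries k := by
          refine sum_le_sum fun k hk => ?_
          have hk3 : 3 ≤ k := (mem_Ico.mp hk).1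
          rw [fiMomentWeight_prime_pow hp k, if_pos hk3, fiMomentSeries]
          have h := pow_div_two_div_pow_le hp.two_le hk3
          have hk0 : (0 : ℝ) ≤ ((k : ℝ) + 1) ^ 18 := by positivity
          calc ((k : ℝ) + 1) ^ 18 * ((p ^ (k / 2) : ℕ) : ℝ) / (p : ℝ) ^ k
              = ((k : ℝ) + 1) ^ 18 * (((p ^ (k / 2) : ℕ) : ℝ) / (p : ℝ) ^ k) := by ring
            _ ≤ ((k : ℝ) + 1) ^ 18 * (4 * ((Real.sqrt 2)⁻¹) ^ k / (p : ℝ) ^ 2) :=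
                mul_le_mul_of_nonneg_left h hk0
            _ = 4 / (p : ℝ) ^ 2 * (((k : ℝ) + 1) ^ 18 * ((Real.sqrt 2)⁻¹) ^ k) := by ring
      _ = 4 / (p : ℝ) ^ 2 * ∑ k ∈ Ico 3 (max N 3), fiMomentSeries k := by rw [mul_sum]
      _ ≤ 4 / (p : ℝ) ^ 2 * fiMomentConst := by
          apply mul_le_mul_of_nonneg_left _ (by positivity)
          exact summable_fiMomentSeries.sum_le_tsum _ fun k _ => fiMomentSeries_nonneg k
      _ = 4 * fiMomentConst / (p : ℝ) ^ 2 := by ring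
  rw [h3]
  have : (3 ^ 18 + 4 * fiMomentConst) / (p : ℝ) ^ 2 =
      3 ^ 18 / (p : ℝ) ^ 2 + 4 * fiMomentConst / (p : ℝ) ^ 2 := by
    ring
  rw [this]
  linarith

/-- `∑_{p ≤ Y} 1/p² ≤ 1`. [folklore] -/
theorem sum_primesLE_inv_sq_le_one (Y : ℕ) : ∑ p ∈ Nat.primesLE Y, ((p : ℝ) ^ 2)⁻¹ ≤ 1 := by
  have hsub : Nat.primesLE Y ⊆ Ioo 1 (Y + 1) := fun p hp => by
    obtain ⟨hpY, hpp⟩ := Nat.mem_primesLE.mp hp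
    exact mem_Ioo.mpr ⟨hpp.one_lt, Nat.lt_succ_of_le hpY⟩
  calc ∑ p ∈ Nat.primesLE Y, ((p : ℝ) ^ 2)⁻¹ ≤ ∑ i ∈ Ioo 1 (Y + 1), ((i : ℝ) ^ 2)⁻¹ :=
        sum_le_sum_of_subset_of_nonneg hsub fun i _ _ => by positivity
    _ ≤ 2 / (1 + 1) := by exact_mod_cast sum_Ioo_inv_sq_le (α := ℝ) 1 (Y + 1)
    _ = 1 := by norm_num

/-- **The Euler product**: `∏_{p ≤ Y} ∑_{k ≤ log₂ Y} h(p^k) ≤ e^{2^{20} + E₀} (log Y)^{2^{18}}` for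
`Y ≥ 2`, `E₀ = 3^{18} + 4E₁`, by `1 + u ≤ e^u`, Mertens' bound `∑_{p ≤ Y} 1/p ≤ log log Y + 4`
(`Literature.NumberTheory.LFunctions.MertensBound.sum_inv_prime_le`) and `∑_p 1/p² ≤ 1`. [folklore] -/
theorem prod_sum_fiMomentWeight_le {Y : ℕ} (hY : 2 ≤ Y) :
    ∏ p ∈ Nat.primesLE Y, ∑ k ∈ range (Nat.log 2 Y + 1), fiMomentWeight (p ^ k) ≤
      Real.exp (2 ^ 20 + (3 ^ 18 + 4 * fiMomentConst)) * Real.log Y ^ (2 ^ 18 : ℕ) := by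
  set E₀ : ℝ := 3 ^ 18 + 4 * fiMomentConst with hE₀
  have hE₀0 : 0 ≤ E₀ := by rw [hE₀]; linarith [fiMomentConst_nonneg]
  set u : ℕ → ℝ := fun p => 2 ^ 18 / (p : ℝ) + E₀ / (p : ℝ) ^ 2 with hu
  have hu0 : ∀ p : ℕ, 0 ≤ u p := fun p => by simp only [hu]; positivity
  have h1 : ∏ p ∈ Nat.primesLE Y, ∑ k ∈ range (Nat.log 2 Y + 1), fiMomentWeight (p ^ k) ≤
      ∏ p ∈ Nat.primesLE Y, Real.exp (u p) := by
    refine prod_le_prod (fun p _ => sum_nonneg fun k _ => fiMomentWeight_nonneg _) fun p hp => ?_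
    have hpp : p.Prime := (Nat.mem_primesLE.mp hp).2
    calc _ ≤ 1 + 2 ^ 18 / (p : ℝ) + E₀ / (p : ℝ) ^ 2 := sum_fiMomentWeight_prime_pow_le hpp _
      _ = u p + 1 := by simp only [hu]; ring
      _ ≤ Real.exp (u p) := Real.add_one_le_exp _
  refine h1.trans ?_
  rw [← Real.exp_sum]
  -- `∑_p u_p ≤ 2^18 (log log Y + 4) + E₀`
  have hY' : (2 : ℝ) ≤ Y := by exact_mod_cast hY
  have hlogY : 0 < Real.log Y := Real.log_pos (by linarith)
  have hsum : ∑ p ∈ Nat.primesLE Y, u p ≤ 2 ^ 18 * (Real.log (Real.log Y) + 4) + E₀ := by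
    have hm := Literature.NumberTheory.LFunctions.MertensBound.sum_inv_prime_le Y hY
    have hsq := sum_primesLE_inv_sq_le_one Y
    simp only [hu, sum_add_distrib]
    have e1 : ∑ p ∈ Nat.primesLE Y, (2 : ℝ) ^ 18 / (p : ℝ) =
        2 ^ 18 * ∑ p ∈ Nat.primesLE Y, 1 / (p : ℝ) := by
      rw [mul_sum]; exact sum_congr rfl fun p _ => by ring
    have e2 : ∑ p ∈ Nat.primesLE Y, E₀ / (p : ℝ) ^ 2 =
        E₀ * ∑ p ∈ Nat.primesLE Y, ((p : ℝ) ^ 2)⁻¹ := by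
      rw [mul_sum]; exact sum_congr rfl fun p _ => by ring
    rw [e1, e2]
    nlinarith [hm, hsq, hE₀0]
  calc Real.exp (∑ p ∈ Nat.primesLE Y, u p)
      ≤ Real.exp (2 ^ 18 * (Real.log (Real.log Y) + 4) + E₀) := Real.exp_le_exp.mpr hsum
    _ = Real.exp (2 ^ 20 + E₀) * Real.log Y ^ (2 ^ 18 : ℕ) := by
        rw [show (2 : ℝ) ^ 18 * (Real.log (Real.log Y) + 4) + E₀ =
          (2 ^ 20 + E₀) + ((2 ^ 18 : ℕ) : ℝ) * Real.log (Real.log Y) by push_cast; ring,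
          Real.exp_add, Real.exp_nat_mul, Real.exp_log hlogY]

/-- **`∑_{d ≤ Y} τ(d)^{18} f(d)/d ≤ e^{2^{20} + E₀} (log Y)^{2^{18}}`** for `Y ≥ 2`. [folklore] -/
theorem sum_fiMomentWeight_le {Y : ℕ} (hY : 2 ≤ Y) :
    ∑ d ∈ Icc 1 Y, fiMomentWeight d ≤
      Real.exp (2 ^ 20 + (3 ^ 18 + 4 * fiMomentConst)) * Real.log Y ^ (2 ^ 18 : ℕ) :=
  (sum_Icc_le_prod_primesLE_sum fiMomentWeight_nonneg fiMomentWeight_one fiMomentWeight_mul Y).trans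
    (prod_sum_fiMomentWeight_le hY)

/-! ### The divisor cube moment of `a_n` -/

/-- `A_d(x) = ∑_{1 ≤ n ≤ ⌊x⌋, d ∣ n} a_n`. [folklore] -/
theorem congrSum_eq_sum_Icc (d : ℕ) (x : ℝ) :
    fiSieveSeq.congrSum d x = ∑ n ∈ (Icc 1 ⌊x⌋₊).filter (d ∣ ·), (fiRepCount n : ℝ) := by
  have hIoc : Ioc 0 ⌊x⌋₊ = Icc 1 ⌊x⌋₊ := by
    ext n; simp only [mem_Ioc, mem_Icc]; omega
  rw [SieveSequence.congrSum, hIoc]; rfl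

/-- A divisor `d(n) ∣ n` with `d(n)³ ≤ n` and `τ(n) ≤ (2τ(d(n)))⁵`
(`exists_divisor_card_divisors_le`; `d(0) = 1`). [folklore] -/
def fiDivSel (n : ℕ) : ℕ :=
  if h : n = 0 then 1 else Classical.choose (exists_divisor_card_divisors_le n h)

/-- The defining properties of `fiDivSel n` for `n ≠ 0`. [folklore] -/
theorem fiDivSel_spec {n : ℕ} (hn : n ≠ 0) :
    fiDivSel n ∣ n ∧ fiDivSel n ^ 3 ≤ n ∧ #n.divisors ≤ (2 * #(fiDivSel n).divisors) ^ 5 := by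
  rw [fiDivSel, dif_neg hn]
  exact Classical.choose_spec (exists_divisor_card_divisors_le n hn)

/-- **The divisor cube moment of `a_n`** (hypothesis (2.8′) of the consumed form of Proposition 2.1,
`SieveSequence.FI1998DivisorCubeMoment fiSieveSeq`, unfolded, with room to spare in the exponent):
`∑_{n ≤ x} a_n τ(n)³ ≤ K A(x) (log x)^{2^8 3^9}` for `x` large; in fact
`∑_{n ≤ x} a_n τ(n)³ ≤ 9 · 2^{15} e^{2^{20}+E₀} x^{3/4} (log x)^{2^{18}}`. Proof:
`τ(n)³ ≤ 2^{15} τ(d_n)^{15}` with `d_n ∣ n`, `d_n ≤ n^{1/3}` (`exists_divisor_card_divisors_le`);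
collecting `n` according to `d = d_n`,
`∑_n a_n τ(n)³ ≤ 2^{15} ∑_{d ≤ x^{1/3}} τ(d)^{15} A_d(x) ≤ 9·2^{15} x^{3/4} ∑_d τ(d)^{18} f(d)/d`
(`congrSum_le_rpow_general`), and `∑_{d ≤ Y} τ(d)^{18} f(d)/d ≤ e^{2^{20}+E₀} (log Y)^{2^{18}}`
(`sum_fiMomentWeight_le`).
[cite: FriedlanderIwaniecASP1998, §9 p. 1062 (the bound for S₂), for the sequence (4.1)] -/
theorem divisorCubeMoment_unfolded :
    ∃ K : ℝ, ∀ᶠ x : ℝ in atTop,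
      ∑ n ∈ Icc 1 ⌊x⌋₊, (fiRepCount n : ℝ) * (ArithmeticFunction.sigma 0 n : ℝ) ^ 3 ≤
        K * fiCount x * Real.log x ^ (2 ^ 8 * 3 ^ 9) := by
  have hκ := friedlanderIwaniecKappa_pos
  set κ := friedlanderIwaniecKappa with hκ_def
  set C₀ : ℝ := Real.exp (2 ^ 20 + (3 ^ 18 + 4 * fiMomentConst)) with hC₀
  have hC₀0 : 0 < C₀ := Real.exp_pos _
  refine ⟨9 * 2 ^ 15 * C₀ / (2 * κ), ?_⟩
  have hb := fiCount_bounds FriedlanderIwaniec1998_count_asymp_holds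
  filter_upwards [hb, eventually_ge_atTop (8 : ℝ), eventually_ge_atTop (Real.exp 1)] with x hAx hx8
    hxe
  have hx1 : (1 : ℝ) ≤ x := by linarith
  have hx0 : (0 : ℝ) < x := by linarith
  set X := ⌊x⌋₊ with hX
  set Y := ⌊x ^ (1 / 3 : ℝ)⌋₊ with hY
  -- `Y ≥ 2`
  have hx13 : (2 : ℝ) ≤ x ^ (1 / 3 : ℝ) := by
    calc (2 : ℝ) = (8 : ℝ) ^ (1 / 3 : ℝ) := by
          rw [show (8 : ℝ) = 2 ^ (3 : ℝ) by norm_num, ← Real.rpow_mul zero_le_two]; norm_num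
      _ ≤ x ^ (1 / 3 : ℝ) := Real.rpow_le_rpow (by norm_num) hx8 (by norm_num)
  have hY2 : 2 ≤ Y := by rw [hY]; exact Nat.le_floor (by exact_mod_cast hx13)
  have hYx : (Y : ℝ) ≤ x ^ (1 / 3 : ℝ) := Nat.floor_le (by positivity)
  -- Step 1: `τ(n)³ ≤ 2^15 τ(d_n)^15`
  have hstep1 : ∀ n ∈ Icc 1 X, (fiRepCount n : ℝ) * (ArithmeticFunction.sigma 0 n : ℝ) ^ 3 ≤
      2 ^ 15 * ((#(fiDivSel n).divisors : ℝ) ^ 15 * (fiRepCount n : ℝ)) := by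
    intro n hn
    have hn0 : n ≠ 0 := by have := (mem_Icc.mp hn).1; omega
    have h := (fiDivSel_spec hn0).2.2
    rw [ArithmeticFunction.sigma_zero_apply]
    have h' : ((#n.divisors : ℕ) : ℝ) ^ 3 ≤ 2 ^ 15 * (#(fiDivSel n).divisors : ℝ) ^ 15 := by
      have : ((#n.divisors : ℕ) : ℝ) ≤ (2 * #(fiDivSel n).divisors : ℕ) ^ 5 := by exact_mod_cast h
      calc ((#n.divisors : ℕ) : ℝ) ^ 3 ≤ (((2 * #(fiDivSel n).divisors : ℕ) : ℝ) ^ 5) ^ 3 :=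
            pow_le_pow_left₀ (Nat.cast_nonneg _) (by exact_mod_cast this) 3
        _ = 2 ^ 15 * (#(fiDivSel n).divisors : ℝ) ^ 15 := by push_cast; ring
    have ha0 : (0 : ℝ) ≤ fiRepCount n := Nat.cast_nonneg _
    nlinarith
  -- Step 2–3: collect by `d = d_n`, fibres are sums over multiples of `d`
  set D := (Icc 1 X).image fiDivSel with hD
  have hDprop : ∀ d ∈ D, 1 ≤ d ∧ (d : ℝ) ≤ x ^ (1 / 3 : ℝ) := by
    intro d hd
    obtain ⟨n, hn, rfl⟩ := mem_image.mp hd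
    obtain ⟨hn1, hnX⟩ := mem_Icc.mp hn
    have hn0 : n ≠ 0 := by omega
    obtain ⟨hdvd, hcube, -⟩ := fiDivSel_spec hn0
    refine ⟨Nat.pos_of_dvd_of_pos hdvd (by omega), ?_⟩
    have h3 : ((fiDivSel n : ℝ)) ^ (3 : ℕ) ≤ x := by
      calc ((fiDivSel n : ℝ)) ^ 3 = ((fiDivSel n ^ 3 : ℕ) : ℝ) := by push_cast; ring
        _ ≤ n := by exact_mod_cast hcube
        _ ≤ X := by exact_mod_cast hnX
        _ ≤ x := Nat.floor_le hx0.le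
    calc (fiDivSel n : ℝ) = (((fiDivSel n : ℝ)) ^ (3 : ℕ)) ^ (1 / 3 : ℝ) := by
          rw [← Real.rpow_natCast, ← Real.rpow_mul (Nat.cast_nonneg _)]; norm_num
      _ ≤ x ^ (1 / 3 : ℝ) := Real.rpow_le_rpow (by positivity) h3 (by norm_num)
  have hstep2 : ∑ n ∈ Icc 1 X, (#(fiDivSel n).divisors : ℝ) ^ 15 * (fiRepCount n : ℝ) ≤
      ∑ d ∈ D, (#d.divisors : ℝ) ^ 15 * fiSieveSeq.congrSum d x := by
    rw [← sum_fiberwise_of_maps_to (g := fiDivSel) (t := D) fun n hn => mem_image_of_mem _ hn]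
    refine sum_le_sum fun d hd => ?_
    rw [sum_congr rfl (g := fun n => (#d.divisors : ℝ) ^ 15 * (fiRepCount n : ℝ))
      fun n hn => by rw [(mem_filter.mp hn).2], ← mul_sum, congrSum_eq_sum_Icc]
    apply mul_le_mul_of_nonneg_left _ (by positivity)
    refine sum_le_sum_of_subset_of_nonneg (fun n hn => ?_) fun n _ _ => Nat.cast_nonneg _
    obtain ⟨hnI, hnd⟩ := mem_filter.mp hn
    have hn0 : n ≠ 0 := by have := (mem_Icc.mp hnI).1; omega
    exact mem_filter.mpr ⟨hnI, hnd ▸ (fiDivSel_spec hn0).1⟩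
  -- Step 4: the crude bound for each `d ∈ D`
  have hstep4 : ∑ d ∈ D, (#d.divisors : ℝ) ^ 15 * fiSieveSeq.congrSum d x ≤
      9 * x ^ (3 / 4 : ℝ) * ∑ d ∈ D, fiMomentWeight d := by
    rw [mul_sum]
    refine sum_le_sum fun d hd => ?_
    obtain ⟨hd1, hdx⟩ := hDprop d hd
    have h := congrSum_le_rpow_general hx1 hd1 hdx
    have hd0 : (0 : ℝ) < d := by exact_mod_cast hd1
    calc (#d.divisors : ℝ) ^ 15 * fiSieveSeq.congrSum d x
        ≤ (#d.divisors : ℝ) ^ 15 * (9 * (#d.divisors : ℝ) ^ 3 * fiLoss d * x ^ (3 / 4 : ℝ) / d) :=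
          mul_le_mul_of_nonneg_left h (by positivity)
      _ = 9 * x ^ (3 / 4 : ℝ) * fiMomentWeight d := by
          rw [fiMomentWeight]; field_simp
  -- Step 5: extend to all `d ≤ Y` and use the Euler product bound
  have hDsub : D ⊆ Icc 1 Y := fun d hd => by
    obtain ⟨hd1, hdx⟩ := hDprop d hd
    exact mem_Icc.mpr ⟨hd1, Nat.le_floor hdx⟩
  have hstep5 : ∑ d ∈ D, fiMomentWeight d ≤ C₀ * Real.log Y ^ (2 ^ 18 : ℕ) :=
    (sum_le_sum_of_subset_of_nonneg hDsub fun d _ _ => fiMomentWeight_nonneg d).trans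
      (sum_fiMomentWeight_le hY2)
  -- Step 6: `log Y ≤ log x`, `log x ≥ 1`, `x^{3/4} ≤ A(x)/(2κ)`
  have hlogx1 : 1 ≤ Real.log x := by
    rw [← Real.log_exp 1]; exact Real.log_le_log (Real.exp_pos 1) hxe
  have hY0 : (0 : ℝ) < Y := by exact_mod_cast (by omega : 0 < Y)
  have hlogY : Real.log Y ≤ Real.log x := by
    apply Real.log_le_log hY0
    calc (Y : ℝ) ≤ x ^ (1 / 3 : ℝ) := hYx
      _ ≤ x ^ (1 : ℝ) := Real.rpow_le_rpow_of_exponent_le hx1 (by norm_num)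
      _ = x := Real.rpow_one x
  have hlogY0 : 0 ≤ Real.log Y := Real.log_nonneg (by exact_mod_cast (by omega : 1 ≤ Y))
  have hlogpow : Real.log Y ^ (2 ^ 18 : ℕ) ≤ Real.log x ^ (2 ^ 8 * 3 ^ 9) :=
    calc Real.log Y ^ (2 ^ 18 : ℕ) ≤ Real.log x ^ (2 ^ 18 : ℕ) := pow_le_pow_left₀ hlogY0 hlogY _
      _ ≤ Real.log x ^ (2 ^ 8 * 3 ^ 9) := pow_le_pow_right₀ hlogx1 (by norm_num)
  have hA : x ^ (3 / 4 : ℝ) ≤ fiCount x / (2 * κ) := by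
    rw [le_div_iff₀ (by positivity)]; linarith [hAx.1]
  -- combine
  calc ∑ n ∈ Icc 1 X, (fiRepCount n : ℝ) * (ArithmeticFunction.sigma 0 n : ℝ) ^ 3
      ≤ ∑ n ∈ Icc 1 X, 2 ^ 15 * ((#(fiDivSel n).divisors : ℝ) ^ 15 * (fiRepCount n : ℝ)) :=
        sum_le_sum hstep1
    _ = 2 ^ 15 * ∑ n ∈ Icc 1 X, (#(fiDivSel n).divisors : ℝ) ^ 15 * (fiRepCount n : ℝ) := by
        rw [mul_sum]
    _ ≤ 2 ^ 15 * (9 * x ^ (3 / 4 : ℝ) * (C₀ * Real.log Y ^ (2 ^ 18 : ℕ))) := by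
        apply mul_le_mul_of_nonneg_left _ (by positivity)
        exact hstep2.trans (hstep4.trans (mul_le_mul_of_nonneg_left hstep5 (by positivity)))
    _ ≤ 2 ^ 15 * (9 * (fiCount x / (2 * κ)) * (C₀ * Real.log x ^ (2 ^ 8 * 3 ^ 9))) := by
        have hA0 : 0 ≤ fiCount x / (2 * κ) := le_trans (by positivity) hA
        apply mul_le_mul_of_nonneg_left _ (by positivity)
        exact mul_le_mul (mul_le_mul_of_nonneg_left hA (by norm_num))
          (mul_le_mul_of_nonneg_left hlogpow hC₀0.le) (mul_nonneg hC₀0.le (pow_nonneg hlogY0 _))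
          (by positivity)
    _ = 9 * 2 ^ 15 * C₀ / (2 * κ) * fiCount x * Real.log x ^ (2 ^ 8 * 3 ^ 9) := by
        field_simp

end Literature.NumberTheory.Sieve.FriedlanderIwaniecPrimes

namespace Literature.NumberTheory.Sieve

/-- **(2.8′) for `a_n`, discharged.**
[cite: FriedlanderIwaniecASP1998, §9 p. 1062 (estimate of S₂), for the sequence (4.1)] -/
theorem FriedlanderIwaniec1998_hyp28_moment_holds : FriedlanderIwaniec1998_hyp28_moment :=
  FriedlanderIwaniecPrimes.divisorCubeMoment_unfolded

namespace FriedlanderIwaniecPrimes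

/-- **(4.7) with (4.8) from the consumed inputs**: Proposition 2.1 (consumed form) applied to
`a_n`, whose corrected hypotheses hold by `fiSieveSeq_hypothesesCubefree` (given Prop. 3.5,
Prop. 4.1, (2.7)) and `FriedlanderIwaniec1998_hyp28_moment_holds`, with `H = 4/π`
(`FriedlanderIwaniec1998_densityConstant_holds`).
[cite: FriedlanderIwaniecAnnals1998, §4, deduction of (4.7) from Propositions 2.1, 3.5, 4.1] -/
theorem primeSum_asymp_of_consumedInputs (h21 : FriedlanderIwaniec1998_prop21_consumed)
    (h35 : FriedlanderIwaniec1998_prop35) (h41 : FriedlanderIwaniec1998_prop41)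
    (h27 : FriedlanderIwaniec1998_hyp27) : FriedlanderIwaniec1998_primeSum_asymp := by
  obtain ⟨B, hB, hhyp⟩ := fiSieveSeq_hypothesesCubefree h35 h41 h27
  have hθ : fiEps < 1 / 3 := by norm_num [fiEps]
  exact h21 fiSieveSeq fiLevel fiP B fiEps (4 / Real.pi) hB (by norm_num [fiEps]) hθ hhyp
    FriedlanderIwaniec1998_hyp28_moment_holds FriedlanderIwaniec1998_densityConstant_holds

end FriedlanderIwaniecPrimes

/-- **(4.7)–(4.8) from the consumed inputs** (Prop. 2.1 consumed form, Prop. 3.5, Prop. 4.1, (2.7)).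
[cite: FriedlanderIwaniecAnnals1998, §4, deduction of (4.7) from Propositions 2.1, 3.5, 4.1] -/
theorem FriedlanderIwaniec1998_primeSum_asymp_of_consumedInputs
    (h21 : FriedlanderIwaniec1998_prop21_consumed) (h35 : FriedlanderIwaniec1998_prop35)
    (h41 : FriedlanderIwaniec1998_prop41) (h27 : FriedlanderIwaniec1998_hyp27) :
    FriedlanderIwaniec1998_primeSum_asymp :=
  FriedlanderIwaniecPrimes.primeSum_asymp_of_consumedInputs h21 h35 h41 h27

/-- **parity.S17 (FI Theorem 1) from four non-refuted named facts**: Proposition 2.1 in the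
consumed form, Proposition 3.5, Proposition 4.1 and (2.7); the other inputs of the printed
architecture — (4.2), (4.8), (2.1), (2.2), (2.4)–(2.6), (2.8) for cubefree moduli, (2.8′), the
parameter ranges and the deduction of (1.1) from (4.7) — are theorems of the tree.
[cite: FriedlanderIwaniecAnnals1998, Theorem 1 via §4] -/
theorem friedlanderIwaniecSum_isEquivalent_of_consumedInputs
    (h21 : FriedlanderIwaniec1998_prop21_consumed) (h35 : FriedlanderIwaniec1998_prop35)
    (h41 : FriedlanderIwaniec1998_prop41) (h27 : FriedlanderIwaniec1998_hyp27) :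
    friedlanderIwaniecSum_isEquivalent :=
  friedlanderIwaniecSum_isEquivalent_of_primeSum
    (FriedlanderIwaniec1998_primeSum_asymp_of_consumedInputs h21 h35 h41 h27)

end Literature.NumberTheory.Sieve
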